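import Summits.BirchSwinnertonDyer.BirchSwinnertonDyer.Theorems.CyclotomicUntwistFiniteSlopeSeparatedPinnedTrace
import Summits.BirchSwinnertonDyer.BirchSwinnertonDyer.Theorems.CyclotomicUntwistPSUntwistingPin
import HarnessLib

/-!
# LAW L-a3 (T), TYPED: the conjecture slot `PSUntwistedTraceLaw` — «every admissible root of the route's D1 object
# is a root of `X² − a_w(W)·X + 3`» — and what it buys: EX⁺ ⟹ EX′, so the intrinsic K-SEP′ filing costs exactly this law
# (route `CyclotomicUntwist`, cruxes K1 `PSRankOneLowerHalfAtThree` / K2 `PSRankOneUpperHalfAtThree`)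

Cell `pub/bsd-wall` (D-0145 line `route-BirchSwinnertonDyer-CyclotomicUntwist`), seat `bsd-line-cycu-p3` (gen 6).
Route Defs file (`--supports stmt-BirchSwinnertonDyer-21580 --as helper`): ONE `@[conjecture] def` (a `Prop`, never
asserted) and theorems about it. No named fact, no `sorry`. BSD is not proved by this file and no crux is; the law below is
OPEN in the tree (informally theorem-grade, see STATUS) and every theorem here takes it as an explicit hypothesis.

THE LAW (`PSUntwistedTraceLaw`). For `W/ℚ` elliptic, globally minimal, on a principal-series row (`ClassO6 W 3`,
`v₃(Δ_min)` even, `Δ_min/3^v ≡ 1 (mod 3)`), every datum `(η, α, 𝓛)` with `η` primitive mod `9` of order Kraus's inertia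
order (`orderOf η = krausInertiaOrderThree W`, i.e. `η` matches the inertia character up to inversion —
`PSUntwistingPin.eq_or_eq_inv_of_match`), `α ≠ 0`, and `IsPSCyclotomicLFunctionOf W η α 𝓛` (D1: `𝓛` is an order-`½`
distribution on `Γ` interpolating `e_n(α)·`(untwisted symbol sums of the newform of `W`)) satisfies
**`α² − a_w(W)·α + 3 = 0`**, `a_w(W) = W.psUntwistedTrace` (`CyclotomicUntwistPSUntwistedTraceDefs`, p616806).

STATUS (informal; nothing of this is asserted). For the INTENDED datum `α = a₃(g)`, `g = (f_W ⊗ η̄)^{new}` of level `9M`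
(for which MTT §I.14 / Bellaïche Thm. 6.7.9 give `𝓛`), the clause is LAW L-a3 (T) of the crux memo `LAW-La3-KERNEL-v3/v4.md`:
`a₃(g) + a₃(ḡ) = a_w(W)`, `a₃(g)·a₃(ḡ) = 3`, by Néron–Ogg–Shafarevich over `ℚ₃(ζ₉)`, Atkin–Li, and Carayol's `ℓ ≠ p`
local–global compatibility (method in print: Dokchitser–Dokchitser, Crelle 717 (2016), «ramified descent»); checked 12/12
(7 sign-sensitive) against the bounded-root scan of the D1 candidate (GZ3-NUMERIC-TEST-v3 §2) and (N′) against Tate's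
algorithm on 24 420 curves. The law ALSO says that no OTHER non-zero `α` admits an order-`½` `𝓛` with D1's interpolation
property: by `CandidateUniqueness.eq_candidate_of_isUntwistedPAdicLFunction` (cycu-p5 g5) any such `𝓛` is cycu-p1's explicit
candidate at `α`, whose growth is order `1` from bounded symbols (`PSF1Curve.hasGrowthOrder_one_candidate`) and order `½`
exactly when the `α`-stabilisation `Σ (α/3)ʲ {∞, 3ʲr}_{f⊗η̄}` is the symbol of a genuine eigenform — the `U₃`-eigenvalue
`a₃(g)` (the conjugate root `ᾱ` belongs to the conjugate character `η̄`, `ConjugateLFunctionsThree`). That converse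
(«tempered stabilisations are eigen-stabilisations») is folklore for `p`-new forms but is NOT located in print by this seat —
hence a conjecture slot, not a Literature fact. `α = 0` must be excluded: the zero system is D1-admissible for odd `η`
(`FiniteSlopeSeparatedPinned.isPSCyclotomicLFunctionOf_zero_zero_of_odd`, cycu-p5 g6) and `0² − a_w·0 + 3 ≠ 0`.

WHAT THE LAW BUYS (theorems of this file).
* `clause_of_law` — unpacking; `admissible_intrinsic_of_law` — under the law, cycu-p5's ADMISSIBLE
  (`η.IsPrimitive ∧ orderOf-match ∧ α ≠ 0 ∧ D1 ∧ ϖ-clause`) implies ADMISSIBLE′ (the intrinsic clause); the converse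
  `α ≠ 0` is `CyclotomicUntwistPinAdmissibleRoot.root_ne_zero_padic` (no law needed).
* **`hEX_trace_of_hEX_match_of_law`** — under the law, the existence hypothesis EX⁺ of the pinned closers, in the MATCHED
  form (witness `η` with `orderOf η = krausInertiaOrderThree W`, as F1's intended witness has), implies the existence
  hypothesis EX′(a_w, ϖ) of `psRankOne_halves_of_separated_pin_trace` (p617798) VERBATIM. So the intrinsic K-SEP′ filing
  is EXACTLY as strong as the `α ≠ 0` filing plus this law on the existence side, while its ∀-children GZ₃′ / pBSD₃′ are
  weaker than the unprimed ones outright (p614028 docstring).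
* `pin_eq_of_law` — under the law, on a PS row every matched admissible datum has `κ = 9η(−1)/α² = W₃(E)·(a_w(W) − α)²`
  (`PSUntwistingPin.pin_eq_rootNumberThree_mul_sq_of_psRow`), and `κ = −3·W₃(E) ∈ ℚ` on the `a_w = 0` third.
* `psRankOneLowerHalfAtThree_of_traceSplit` / `psRankOneUpperHalfAtThree_of_traceSplit` — K1 / K2 from their
  restrictions to the decidable sub-rows `a_w(W) = 0` and `a_w(W) ≠ 0` (`FiniteSlopeSeparated.…_of_rowSplit` at
  `Φ := (psUntwistedTrace · = 0)`; the memo's «first rung» sub-row, by name).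

References: B. Mazur, J. Tate, J. Teitelbaum, Invent. Math. 84 (1986) §I.14 [MazurTateTeitelbaum1986Invent]; J. Bellaïche,
*The Eigenbook* (2021) Thm. 6.2.13, Thm. 6.7.9 [Bellaiche2021]; H. Carayol, Ann. Sci. ÉNS 19 (1986) [Carayol1986];
A. O. L. Atkin, W.-C. W. Li, Invent. Math. 48 (1978) Thm. 3.1 [AtkinLi1978]; D. Rohrlich, CRM Proc. Lecture Notes 4 (1994)
§19 [Rohrlich1994CRM]; A. Kraus, Manuscripta Math. 69 (1990) [Kraus1990].
-/

set_option autoImplicit false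
-- single-conjunct summit: `Summit.BirchSwinnertonDyer.BirchSwinnertonDyer.…` repeats the name by design
set_option linter.dupNamespace false

noncomputable section

open scoped Classical MatrixGroups

open CongruenceSubgroup WeierstrassCurve WeierstrassCurve.Affine.Point Literature.NumberTheory.EllipticCurves
  Literature.NumberTheory.EllipticCurves.ModularForms Literature.NumberTheory.EllipticCurves.Rank1Residual
  Literature.NumberTheory.IwasawaTheory Summit.BirchSwinnertonDyer.Rank1Residual.Additive
  Summit.BirchSwinnertonDyer.BirchSwinnertonDyer.Theses.CyclotomicUntwist
  Summit.BirchSwinnertonDyer.BirchSwinnertonDyer.Theorems.PSUntwistedTrace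

namespace Summit.BirchSwinnertonDyer.BirchSwinnertonDyer.Theorems.PSUntwistedTraceLaw

/-! ### The conjecture slot -/

/-- **LAW L-a3 (T), typed — OPEN; nothing asserted.** On every principal-series row of route `CyclotomicUntwist`
(`W/ℚ` elliptic, globally minimal, `ClassO6 W 3`, `v₃Δ_min` even, `Δ_min/3^v ≡ 1 (mod 3)`), every datum `(η, α, 𝓛)` with
`η` primitive mod `9` of order `krausInertiaOrderThree W`, `α ≠ 0` and `IsPSCyclotomicLFunctionOf W η α 𝓛` has
`α² − a_w(W)·α + 3 = 0`, `a_w(W) = W.psUntwistedTrace`. Informally: `α ∈ {a₃(g), a₃(ḡ)}` for the untwist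
`g = (f_W ⊗ η̄)^{new}` and `a₃(g) + a₃(ḡ) = a_w(W)` is the Frobenius trace of `W` over `ℚ₃(ζ₉)` (module docstring, STATUS).
A `Prop` constant; CONDITIONAL wherever used. [cite: MazurTateTeitelbaum1986Invent, §I.14] [cite: Carayol1986, Thm. (A)]
[cite: AtkinLi1978, Thm. 3.1] [cite: Kraus1990, Théorème (p = 3)] -/
@[conjecture]
def PSUntwistedTraceLaw : Prop :=
  ∀ (W : WeierstrassCurve ℚ) [W.IsElliptic] [W.IsGloballyMinimal],
    Summit.BirchSwinnertonDyer.Rank1Residual.Additive.ClassO6 W 3 →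
    Even (padicValInt 3 W.minimalDiscriminantInt) →
    W.minimalDiscriminantInt / 3 ^ padicValInt 3 W.minimalDiscriminantInt % 3 = 1 →
    ∀ (η : DirichletCharacter ℂ_[3] (3 ^ 2)) (α : ℂ_[3]) (𝓛 : (n : ℕ) → ZMod (3 ^ n) → ℂ_[3]),
      η.IsPrimitive → orderOf η = krausInertiaOrderThree W → α ≠ 0 → IsPSCyclotomicLFunctionOf W η α 𝓛 →
        α ^ 2 - ((W.psUntwistedTrace : ℤ) : ℂ_[3]) * α + 3 = 0

/-! ### What the law gives a matched admissible datum -/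

section Clause

variable {W : WeierstrassCurve ℚ} [W.IsElliptic] [W.IsGloballyMinimal]
  {η : DirichletCharacter ℂ_[3] (3 ^ 2)} {α : ℂ_[3]} {𝓛 : (n : ℕ) → ZMod (3 ^ n) → ℂ_[3]}

/-- Unpacking the law on one datum. [folklore] -/
theorem clause_of_law (hlaw : PSUntwistedTraceLaw) (hO6 : ClassO6 W 3)
    (hev : Even (padicValInt 3 W.minimalDiscriminantInt))
    (hps : W.minimalDiscriminantInt / 3 ^ padicValInt 3 W.minimalDiscriminantInt % 3 = 1)
    (hη : η.IsPrimitive) (hmatch : orderOf η = krausInertiaOrderThree W) (hα : α ≠ 0)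
    (hμ : IsPSCyclotomicLFunctionOf W η α 𝓛) :
    α ^ 2 - ((W.psUntwistedTrace : ℤ) : ℂ_[3]) * α + 3 = 0 :=
  hlaw W hO6 hev hps η α 𝓛 hη hmatch hα hμ

/-- **Under the law, the pin is `κ = W₃(E)·(a_w(W) − α)²`** for every matched admissible datum on a PS row
(`PSUntwistingPin.pin_eq_rootNumberThree_mul_sq_of_psRow` at `a := a_w(W)`); on the `a_w(W) = 0` third `κ = −3·W₃(E)`.
[cite: MazurTateTeitelbaum1986Invent, §I.14] [cite: Rizzo2003, Table II (p. 4)] -/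
theorem pin_eq_of_law (hlaw : PSUntwistedTraceLaw) (hO6 : ClassO6 W 3)
    (hev : Even (padicValInt 3 W.minimalDiscriminantInt))
    (hps : W.minimalDiscriminantInt / 3 ^ padicValInt 3 W.minimalDiscriminantInt % 3 = 1)
    (hη : η.IsPrimitive) (hmatch : orderOf η = krausInertiaOrderThree W) (hα : α ≠ 0)
    (hμ : IsPSCyclotomicLFunctionOf W η α 𝓛) :
    (9 * η (-1) / α ^ 2 : ℂ_[3]) = (W.rootNumberThree : ℂ_[3]) * (((W.psUntwistedTrace : ℤ) : ℂ_[3]) - α) ^ 2 ∧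
      (W.psUntwistedTrace = 0 → (9 * η (-1) / α ^ 2 : ℂ_[3]) = -3 * (W.rootNumberThree : ℂ_[3])) := by
  have hcl := clause_of_law hlaw hO6 hev hps hη hmatch hα hμ
  have hsq : α ^ 2 = ((W.psUntwistedTrace : ℤ) : ℂ_[3]) * α - 3 := by linear_combination hcl
  refine ⟨PSUntwistingPin.pin_eq_rootNumberThree_mul_sq_of_psRow η W hO6 hev hps hη hmatch hsq, fun h0 ↦ ?_⟩
  have hsq' : α ^ 2 = -3 := by rw [h0] at hsq; push_cast at hsq; linear_combination hsq
  exact PSUntwistingPin.pin_eq_neg_three_mul_rootNumberThree_of_psRow η W hO6 hev hps hη hmatch hsq'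

end Clause

/-! ### EX⁺ (matched, `α ≠ 0`) ⟹ EX′ (intrinsic clause) under the law -/

section Existence

variable {R : Type} [CommRing R] [Algebra ℚ_[3] R]

/-- **The intrinsic existence hypothesis from the `α ≠ 0` one, under the law.** If on every rank-one PS row there is a
MATCHED admissible datum — `η` primitive with `orderOf η = krausInertiaOrderThree W`, `α ≠ 0`,
`IsPSCyclotomicLFunctionOf W η α 𝓛`, the period ratio `ϖ`, a canonical `Dh` — together with a GZ-rational `q` (this is
EX⁺(ϖ) of `CyclotomicUntwistFiniteSlopeSeparatedPinnedPeriod` with the order conjunct F1's intended witness carries), then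
`PSUntwistedTraceLaw` gives the hypothesis `hEX` of `CyclotomicUntwistFiniteSlopeSeparatedPinnedTrace.psRankOne_halves_of_separated_pin_trace`
VERBATIM (clause `α² − (W.psUntwistedTrace)·α + 3 = 0`). [cite: MazurTateTeitelbaum1986Invent, §I.14] -/
theorem hEX_trace_of_hEX_match_of_law (hlaw : PSUntwistedTraceLaw)
    (Can : (W : WeierstrassCurve ℚ) → DirichletCharacter ℂ_[3] (3 ^ 2) → ℂ_[3] → W.PSLineHeightData R → Prop)
    (hEX : ∀ (W : WeierstrassCurve ℚ) [W.IsElliptic] [W.IsGloballyMinimal], ¬ W.HasCM →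
      Summit.BirchSwinnertonDyer.Rank1Residual.Additive.ClassO6 W 3 → Surj W 3 →
      Even (padicValInt 3 W.minimalDiscriminantInt) →
      W.minimalDiscriminantInt / 3 ^ padicValInt 3 W.minimalDiscriminantInt % 3 = 1 →
      W.analyticRank = 1 →
      (∃ (η : DirichletCharacter ℂ_[3] (3 ^ 2)) (α : ℂ_[3]) (𝓛 : (n : ℕ) → ZMod (3 ^ n) → ℂ_[3]) (ϖ : ℚ),
          η.IsPrimitive ∧ orderOf η = krausInertiaOrderThree W ∧ α ≠ 0 ∧ IsPSCyclotomicLFunctionOf W η α 𝓛 ∧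
          (∀ {N : ℕ} [NeZero N] (f : CuspForm (Gamma0 N) 2), IsNewformOf W f →
            (ϖ : ℝ) * W.realPeriodRat = plusPeriod f) ∧
            ∃ Dh : W.PSLineHeightData R, Can W η α Dh) ∧
        ∃ q : ℚ, W.leadingLCoeff = (((q : ℝ) * W.realPeriodRat * W.regulator : ℝ) : ℂ)) :
    ∀ (W : WeierstrassCurve ℚ) [W.IsElliptic] [W.IsGloballyMinimal], ¬ W.HasCM →
      Summit.BirchSwinnertonDyer.Rank1Residual.Additive.ClassO6 W 3 → Surj W 3 →
      Even (padicValInt 3 W.minimalDiscriminantInt) →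
      W.minimalDiscriminantInt / 3 ^ padicValInt 3 W.minimalDiscriminantInt % 3 = 1 →
      W.analyticRank = 1 →
      (∃ (η : DirichletCharacter ℂ_[3] (3 ^ 2)) (α : ℂ_[3]) (𝓛 : (n : ℕ) → ZMod (3 ^ n) → ℂ_[3]) (ϖ : ℚ),
          η.IsPrimitive ∧ α ^ 2 - ((W.psUntwistedTrace : ℤ) : ℂ_[3]) * α + 3 = 0 ∧ IsPSCyclotomicLFunctionOf W η α 𝓛 ∧
          (∀ {N : ℕ} [NeZero N] (f : CuspForm (Gamma0 N) 2), IsNewformOf W f →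
            (ϖ : ℝ) * W.realPeriodRat = plusPeriod f) ∧
            ∃ Dh : W.PSLineHeightData R, Can W η α Dh) ∧
        ∃ q : ℚ, W.leadingLCoeff = (((q : ℝ) * W.realPeriodRat * W.regulator : ℝ) : ℂ) := by
  intro W _ _ hCM hO6 hsurj hev hsq hr
  obtain ⟨⟨η, α, 𝓛, ϖ, hη, hmatch, hα, hμ, hϖ, Dh, hDh⟩, hq⟩ := hEX W hCM hO6 hsurj hev hsq hr
  exact ⟨⟨η, α, 𝓛, ϖ, hη, clause_of_law hlaw hO6 hev hsq hη hmatch hα hμ, hμ, hϖ, Dh, hDh⟩, hq⟩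

/-- Conversely (no law needed): the intrinsic clause gives back `α ≠ 0`, so EX′ ⟹ EX⁺ without the order conjunct —
`CyclotomicUntwistPinAdmissibleRoot.root_ne_zero_padic`. [folklore] -/
theorem ne_zero_of_clause {W : WeierstrassCurve ℚ} {α : ℂ_[3]}
    (h : α ^ 2 - ((W.psUntwistedTrace : ℤ) : ℂ_[3]) * α + 3 = 0) : α ≠ 0 :=
  CyclotomicUntwistPinAdmissibleRoot.root_ne_zero_padic h

end Existence

/-! ### The `a_w = 0` / `a_w ≠ 0` split of K1 and K2, by name -/

section Split

/-- **K1 from its two trace sub-rows.** `PSRankOneLowerHalfAtThree` follows from its restriction to the rows with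
`a_w(W) = 0` (the memo's «first rung»: `α² = −3`, `κ = −3·W₃ ∈ ℚ`; `133` of the `416` K1/K2 classes with `N < 5·10⁵`;
decidable predicate `Δ′ ≡ 7 (9)` on II/IV*, `c₆ᵘ ≡ ±4 (9)` on IV/II*, `PSUntwistedTrace.psUntwistedTrace_eq_zero_iff_*`)
and to the rows with `a_w(W) ≠ 0` (`= ±3`). [folklore] -/
theorem psRankOneLowerHalfAtThree_of_traceSplit
    (h0 : ∀ (W : WeierstrassCurve ℚ) [W.IsElliptic] [W.IsGloballyMinimal], ¬ W.HasCM →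
      Summit.BirchSwinnertonDyer.Rank1Residual.Additive.ClassO6 W 3 → Surj W 3 →
      Even (padicValInt 3 W.minimalDiscriminantInt) →
      W.minimalDiscriminantInt / 3 ^ padicValInt 3 W.minimalDiscriminantInt % 3 = 1 →
      W.analyticRank = 1 → W.psUntwistedTrace = 0 → Typed.MissingLowerBoundAt W 3)
    (h1 : ∀ (W : WeierstrassCurve ℚ) [W.IsElliptic] [W.IsGloballyMinimal], ¬ W.HasCM →
      Summit.BirchSwinnertonDyer.Rank1Residual.Additive.ClassO6 W 3 → Surj W 3 →
      Even (padicValInt 3 W.minimalDiscriminantInt) →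
      W.minimalDiscriminantInt / 3 ^ padicValInt 3 W.minimalDiscriminantInt % 3 = 1 →
      W.analyticRank = 1 → W.psUntwistedTrace ≠ 0 → Typed.MissingLowerBoundAt W 3) :
    PSRankOneLowerHalfAtThree :=
  CyclotomicUntwistFiniteSlopeSeparated.psRankOneLowerHalfAtThree_of_rowSplit (fun W ↦ W.psUntwistedTrace = 0) h0 h1

/-- **K2 from its two trace sub-rows** (same split). [folklore] -/
theorem psRankOneUpperHalfAtThree_of_traceSplit
    (h0 : ∀ (W : WeierstrassCurve ℚ) [W.IsElliptic] [W.IsGloballyMinimal], ¬ W.HasCM →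
      Summit.BirchSwinnertonDyer.Rank1Residual.Additive.ClassO6 W 3 → Surj W 3 →
      Even (padicValInt 3 W.minimalDiscriminantInt) →
      W.minimalDiscriminantInt / 3 ^ padicValInt 3 W.minimalDiscriminantInt % 3 = 1 →
      W.analyticRank = 1 → W.psUntwistedTrace = 0 → Typed.MissingUpperBoundAt W 3)
    (h1 : ∀ (W : WeierstrassCurve ℚ) [W.IsElliptic] [W.IsGloballyMinimal], ¬ W.HasCM →
      Summit.BirchSwinnertonDyer.Rank1Residual.Additive.ClassO6 W 3 → Surj W 3 →
      Even (padicValInt 3 W.minimalDiscriminantInt) →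
      W.minimalDiscriminantInt / 3 ^ padicValInt 3 W.minimalDiscriminantInt % 3 = 1 →
      W.analyticRank = 1 → W.psUntwistedTrace ≠ 0 → Typed.MissingUpperBoundAt W 3) :
    PSRankOneUpperHalfAtThree :=
  CyclotomicUntwistFiniteSlopeSeparated.psRankOneUpperHalfAtThree_of_rowSplit (fun W ↦ W.psUntwistedTrace = 0) h0 h1

end Split

/-! ### Appendix (same seat, appended): the rank-ZERO existence hypothesis under the law -/

section ExistenceRankZero

/-- **EX₀⁺(matched, `α ≠ 0`) ⟹ EX₀′(a_w) under the law** — the rank-zero analogue of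
`hEX_trace_of_hEX_match_of_law`: if on every rank-ZERO PS row there is a matched admissible datum (`η` primitive,
`orderOf η = krausInertiaOrderThree W`, `α ≠ 0`, `IsPSCyclotomicLFunctionOf W η α 𝓛`, period ratio `ϖ`), then
`PSUntwistedTraceLaw` gives the hypothesis `hEX0` of
`CyclotomicUntwistFiniteSlopeRankZeroPinnedTrace.rankZero_halves_of_pBSD3_pin_trace` /
`…psRankOneUpperHalfAtThree_of_koTowerFree_of_pBSD3_rankZero_pin_trace` VERBATIM (clause
`α² − (W.psUntwistedTrace)·α + 3 = 0`). So K2's pinned road with the intrinsic clause costs exactly this law on the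
existence side too. [cite: MazurTateTeitelbaum1986Invent, §I.14] -/
theorem hEX0_trace_of_hEX0_match_of_law (hlaw : PSUntwistedTraceLaw)
    (hEX0 : ∀ (W : WeierstrassCurve ℚ) [W.IsElliptic] [W.IsGloballyMinimal], ¬ W.HasCM →
      Summit.BirchSwinnertonDyer.Rank1Residual.Additive.ClassO6 W 3 → Surj W 3 →
      Even (padicValInt 3 W.minimalDiscriminantInt) →
      W.minimalDiscriminantInt / 3 ^ padicValInt 3 W.minimalDiscriminantInt % 3 = 1 →
      W.analyticRank = 0 →
      ∃ (η : DirichletCharacter ℂ_[3] (3 ^ 2)) (α : ℂ_[3]) (𝓛 : (n : ℕ) → ZMod (3 ^ n) → ℂ_[3]) (ϖ : ℚ),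
        η.IsPrimitive ∧ orderOf η = krausInertiaOrderThree W ∧ α ≠ 0 ∧ IsPSCyclotomicLFunctionOf W η α 𝓛 ∧
        (∀ {N : ℕ} [NeZero N] (f : CuspForm (Gamma0 N) 2), IsNewformOf W f →
          (ϖ : ℝ) * W.realPeriodRat = plusPeriod f)) :
    ∀ (W : WeierstrassCurve ℚ) [W.IsElliptic] [W.IsGloballyMinimal], ¬ W.HasCM →
      Summit.BirchSwinnertonDyer.Rank1Residual.Additive.ClassO6 W 3 → Surj W 3 →
      Even (padicValInt 3 W.minimalDiscriminantInt) →
      W.minimalDiscriminantInt / 3 ^ padicValInt 3 W.minimalDiscriminantInt % 3 = 1 →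
      W.analyticRank = 0 →
      ∃ (η : DirichletCharacter ℂ_[3] (3 ^ 2)) (α : ℂ_[3]) (𝓛 : (n : ℕ) → ZMod (3 ^ n) → ℂ_[3]) (ϖ : ℚ),
        η.IsPrimitive ∧ α ^ 2 - ((W.psUntwistedTrace : ℤ) : ℂ_[3]) * α + 3 = 0 ∧ IsPSCyclotomicLFunctionOf W η α 𝓛 ∧
        (∀ {N : ℕ} [NeZero N] (f : CuspForm (Gamma0 N) 2), IsNewformOf W f →
          (ϖ : ℝ) * W.realPeriodRat = plusPeriod f) := by
  intro W _ _ hCM hO6 hsurj hev hsq hr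
  obtain ⟨η, α, 𝓛, ϖ, hη, hmatch, hα, hμ, hϖ⟩ := hEX0 W hCM hO6 hsurj hev hsq hr
  exact ⟨η, α, 𝓛, ϖ, hη, clause_of_law hlaw hO6 hev hsq hη hmatch hα hμ, hμ, hϖ⟩

end ExistenceRankZero

end Summit.BirchSwinnertonDyer.BirchSwinnertonDyer.Theorems.PSUntwistedTraceLaw

end
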